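import Literature.Topology.PlanarFoliations.StarHorizFamily
import Literature.Topology.PlanarFoliations.ProngTailsOrder
import HarnessLib

/-!
# The direction of a prong: in-prongs and out-prongs from the chart type

Topic: Topology / PlanarFoliations, sequel to `StarHorizFamily.lean` (the horizontals near a
prong point read in one flow box, with one monotonicity type), `ProngTailsOrder.lean`,
`LeafOrder.lean`. Let the prong arc `b ↦ horiz j 0 b`, `0 < b ≤ ρ`, of the sector `j` lie in
an open leaf `L` (its separatrix). In a flow box `e` of the atlas around a prong point the leaf
coordinate is strictly monotone in `b` (`exists_box_uniform_type`); we prove: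

* `leafLT_prongPt_of_lt` (**proved**): if it is *increasing* near one prong point then **the
  whole prong arc is traversed forward by increasing `b`** (the leaf order is the chart
  coordinate on plaques, `leafArc_lt_iff`; a continuous injective arc of a line leaf is monotone);
* `exists_prongPt_lt` (**proved**): the prong arc is **cofinal backward** in the leaf (its image
  accumulates at the puncture, off the domain, so it is in no compact leaf interval);
* `mem_alphaSet_of_strictMonoOn` (**proved**): hence **the puncture is in the α-limit set** of
  the leaf — the prong is an *out-prong* (the leaf leaves `v` along it);
* the mirror statements for a *decreasing* chart type (`leafLT_prongPt_of_lt'`,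
  `exists_lt_prongPt`, `mem_omegaSet_of_strictAntiOn`): an *in-prong*.

All statements are [folklore].
-/

noncomputable section

open Set Filter Function
open _root_.Topology
open Literature.Topology.FourManifolds Literature.Topology.FourManifolds.Foliation

namespace Literature.Topology.PlanarFoliations

namespace ProngStar

variable {X : Type*} [TopologicalSpace X] [T2Space X] [SecondCountableTopology X] [Nonempty X] {F : Foliation ℝ X}
  {ι : X → ℂ} {v : ℂ} {n : ℕ} (P : ProngStar F ι v n) (hι : IsOpenEmbedding ι) (hbi : IsBiOriented F)
variable {x : X} [NoncompactSpace (F.Leaf x)] {j : ZMod n} (hx : ∀ b ∈ Ioc 0 P.ρ, P.horiz hι j 0 b ∈ F.leaf x)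

/-- **The points of the prong arc as points of the open leaf** (junk off the arc). [folklore] -/
def prongPt (hx : ∀ b ∈ Ioc 0 P.ρ, P.horiz hι j 0 b ∈ F.leaf x) (b : ℝ) : F.Leaf x :=
  if hb : b ∈ Ioc 0 P.ρ then leafPt (P.horiz hι j 0 b) (hx b hb) else Leaf.base F x

variable {P hι hx}

omit [T2Space X] [SecondCountableTopology X] [NoncompactSpace (F.Leaf x)] in
/-- The underlying point of a prong point. [folklore] -/
theorem pt_prongPt {b : ℝ} (hb : b ∈ Ioc 0 P.ρ) : Leaf.pt (P.prongPt hι hx b) = P.horiz hι j 0 b := by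
  rw [prongPt, dif_pos hb]; rfl

omit [T2Space X] [SecondCountableTopology X] [Nonempty X] [NoncompactSpace (F.Leaf x)] in
/-- The parameters of the prong arc are admissible. [folklore] -/
theorem rect_of_mem_Ioc {b : ℝ} (hb : b ∈ Ioc 0 P.ρ) : ((b, (0 : ℝ)) : ℝ × ℝ) ∈ P.rect ∧ ((b, (0 : ℝ)) : ℝ × ℝ) ≠ 0 :=
  ⟨(P.mem_rect_iff).2 ⟨⟨hb.1.le, hb.2⟩, by simp [P.ρ_pos.le]⟩, fun h ↦ by have := congrArg Prod.fst h; simp at this; linarith [hb.1]⟩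

omit [T2Space X] [SecondCountableTopology X] [NoncompactSpace (F.Leaf x)] in
/-- The image of a prong point. [folklore] -/
theorem ι_prongPt {b : ℝ} (hb : b ∈ Ioc 0 P.ρ) : ι (Leaf.pt (P.prongPt hι hx b)) = P.pt j (b, 0) := by
  rw [pt_prongPt hb]; exact P.ι_horiz hι (rect_of_mem_Ioc hb).1 (rect_of_mem_Ioc hb).2

omit [T2Space X] [SecondCountableTopology X] [NoncompactSpace (F.Leaf x)] in
/-- The prong arc is injective. [folklore] -/
theorem prongPt_injOn : InjOn (P.prongPt hι hx) (Ioc 0 P.ρ) := fun b hb b' hb' h ↦ by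
  have := congrArg (fun q ↦ ι (Leaf.pt q)) h
  simp only [ι_prongPt hb, ι_prongPt hb'] at this
  have hpq : ((b, (0 : ℝ)) : ℝ × ℝ) = (b', 0) := by
    rw [← P.chart_pt (rect_of_mem_Ioc hb).1 (j := j), ← P.chart_pt (rect_of_mem_Ioc hb').1 (j := j), this]
  exact congrArg Prod.fst hpq

omit [T2Space X] [SecondCountableTopology X] [NoncompactSpace (F.Leaf x)] in
/-- The prong arc is continuous in the leaf topology. [folklore] -/
theorem continuousOn_prongPt : ContinuousOn (P.prongPt hι hx) (Ioc 0 P.ρ) :=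
  continuousOn_leafPt (P.continuousOn_toLeafSpace_horiz hι fun b hb ↦ rect_of_mem_Ioc hb) hx fun b hb ↦ by
    rw [prongPt, dif_pos hb]

omit [T2Space X] [SecondCountableTopology X] [NoncompactSpace (F.Leaf x)] in
/-- **The puncture is a limit of the images of the prong points with small parameter.**
[folklore] -/
theorem mem_closure_image_prongPt {b : ℝ} (hb : b ∈ Ioc 0 P.ρ) :
    v ∈ closure ((fun q : F.Leaf x ↦ ι (Leaf.pt q)) '' (P.prongPt hι hx '' Ioc 0 b)) := by
  have hI : Ioc 0 b ⊆ Ioc 0 P.ρ := fun b' hb' ↦ ⟨hb'.1, hb'.2.trans hb.2⟩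
  -- `b' ↦ pt j (b', 0) → pt j (0, 0) = v` as `b' → 0⁺`
  have h00 : (((0 : ℝ), (0 : ℝ)) : ℝ × ℝ) ∈ P.rect := (P.mem_rect_iff).2 ⟨⟨le_rfl, P.ρ_pos.le⟩, by simp [P.ρ_pos.le]⟩
  have hcurve : Continuous fun b' : ℝ ↦ ((b', (0 : ℝ)) : ℝ × ℝ) := continuous_id.prodMk continuous_const
  have hmaps : MapsTo (fun b' : ℝ ↦ ((b', (0 : ℝ)) : ℝ × ℝ)) (Ioo 0 b) P.rect := fun b' hb' ↦ (rect_of_mem_Ioc (hI ⟨hb'.1, hb'.2.le⟩)).1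
  have htend : Tendsto (fun b' : ℝ ↦ P.pt j (b', 0)) (𝓝[Ioo 0 b] 0) (𝓝 v) := by
    have h1 : Tendsto (fun b' : ℝ ↦ ((b', (0 : ℝ)) : ℝ × ℝ)) (𝓝[Ioo 0 b] 0) (𝓝[P.rect] (0, 0)) :=
      tendsto_nhdsWithin_of_tendsto_nhds_of_eventually_within _ (hcurve.tendsto' 0 (0, 0) rfl |>.mono_left nhdsWithin_le_nhds)
        (eventually_nhdsWithin_of_forall hmaps)
    have h2 := ((P.continuousOn_pt j) _ h00).tendsto.comp h1
    rwa [Prod.mk_zero_zero, P.pt_zero] at h2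
  haveI : (𝓝[Ioo 0 b] (0 : ℝ)).NeBot := left_nhdsWithin_Ioo_neBot hb.1
  refine mem_closure_of_tendsto htend (eventually_nhdsWithin_of_forall fun b' hb' ↦ ?_)
  exact ⟨P.prongPt hι hx b', ⟨b', ⟨hb'.1, hb'.2.le⟩, rfl⟩, ι_prongPt (hI ⟨hb'.1, hb'.2.le⟩)⟩

/-! ## Increasing chart type: an out-prong -/

/-- **Local forward order from an increasing chart type**: in a flow box of the atlas reading the
prong arc near `b₀` in one plaque with increasing leaf coordinate, larger parameters are later
in the leaf. [folklore] -/
theorem leafLT_prongPt_local {e : OpenPartialHomeomorph X (ℝ × ℝ)} (he : e ∈ F.atlas) {b₀ δ : ℝ}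
    (hI : Icc (b₀ - δ) (b₀ + δ) ⊆ Ioc 0 P.ρ)
    (hsrc : ∀ β ∈ Icc (b₀ - δ) (b₀ + δ), P.horiz hι j 0 β ∈ e.source ∧ (e (P.horiz hι j 0 β)).2 = (e (P.horiz hι j 0 b₀)).2)
    (hmono : StrictMonoOn (fun β ↦ (e (P.horiz hι j 0 β)).1) (Icc (b₀ - δ) (b₀ + δ)))
    {b b' : ℝ} (hb : b ∈ Icc (b₀ - δ) (b₀ + δ)) (hb' : b' ∈ Icc (b₀ - δ) (b₀ + δ)) (hbb' : b < b') :
    leafLT hbi (P.prongPt hι hx b) (P.prongPt hι hx b') := by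
  set t := (e (P.horiz hι j 0 b₀)).2 with ht
  have hplaque : ∀ β ∈ Icc (b₀ - δ) (b₀ + δ), P.horiz hι j 0 β ∈ plaque e t := fun β hβ ↦ ⟨(hsrc β hβ).1, (hsrc β hβ).2⟩
  have hδ : 0 ≤ δ := by linarith [hb.1, hb.2]
  have hb₀ : b₀ ∈ Icc (b₀ - δ) (b₀ + δ) := ⟨by linarith, by linarith⟩
  have hsub : plaque e t ⊆ F.leaf x := F.plaque_subset_leaf_of_mem he (hx b₀ (hI hb₀)) (hplaque b₀ hb₀)
  have hsource : ∀ β (hβ : β ∈ Icc (b₀ - δ) (b₀ + δ)), P.prongPt hι hx β ∈ (leafArc e t hsub he).source := fun β hβ ↦ by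
    rw [mem_leafArc_source_iff]
    show Leaf.pt (P.prongPt hι hx β) ∈ plaque e t
    rw [pt_prongPt (hI hβ)]; exact hplaque β hβ
  rw [← leafArc_lt_iff (hbi := hbi) he hsub (hsource b hb) (hsource b' hb'), leafArc_apply hsub he (hsource b hb),
    leafArc_apply hsub he (hsource b' hb')]
  show (e (Leaf.pt (P.prongPt hι hx b))).1 < (e (Leaf.pt (P.prongPt hι hx b'))).1
  rw [pt_prongPt (hI hb), pt_prongPt (hI hb')]
  exact hmono hb hb' hbb'

/-- **Global forward order from an increasing chart type at one prong point**: the whole prong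
arc is traversed forward by increasing parameter. [folklore] -/
theorem leafLT_prongPt_of_lt {e : OpenPartialHomeomorph X (ℝ × ℝ)} (he : e ∈ F.atlas) {b₀ δ : ℝ} (hδ : 0 < δ)
    (hI : Icc (b₀ - δ) (b₀ + δ) ⊆ Ioc 0 P.ρ)
    (hsrc : ∀ β ∈ Icc (b₀ - δ) (b₀ + δ), P.horiz hι j 0 β ∈ e.source ∧ (e (P.horiz hι j 0 β)).2 = (e (P.horiz hι j 0 b₀)).2)
    (hmono : StrictMonoOn (fun β ↦ (e (P.horiz hι j 0 β)).1) (Icc (b₀ - δ) (b₀ + δ)))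
    {b b' : ℝ} (hb : b ∈ Ioc 0 P.ρ) (hb' : b' ∈ Ioc 0 P.ρ) (hbb' : b < b') :
    leafLT hbi (P.prongPt hι hx b) (P.prongPt hι hx b') := by
  -- the compact piece `[b₁, ρ]` of the arc containing `b`, `b'` and the box interval, read in one line chart
  set b₁ := min b (b₀ - δ) with hb₁
  have hb₁pos : 0 < b₁ := lt_min hb.1 (hI ⟨le_rfl, by linarith⟩).1
  set T := Icc b₁ P.ρ with hT
  have hTsub : T ⊆ Ioc 0 P.ρ := fun β hβ ↦ ⟨hb₁pos.trans_le hβ.1, hβ.2⟩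
  have hcT : ContinuousOn (P.prongPt hι hx) T := continuousOn_prongPt.mono hTsub
  have hKc : IsCompact (P.prongPt hι hx '' T) := isCompact_Icc.image_of_continuousOn hcT
  obtain ⟨N, hN⟩ := exists_subset_lineCharts_source (hbi := hbi) hKc
  set g : ℝ → ℝ := fun β ↦ lineCharts hbi x N (P.prongPt hι hx β) with hg
  have hgc : ContinuousOn g T := (lineCharts hbi x N).continuousOn.comp hcT fun β hβ ↦ hN ⟨β, hβ, rfl⟩
  have hgi : InjOn g T := fun β hβ β' hβ' h ↦
    prongPt_injOn (hTsub hβ) (hTsub hβ') ((lineCharts hbi x N).injOn (hN ⟨β, hβ, rfl⟩) (hN ⟨β', hβ', rfl⟩) h)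
  have hρT : b₁ ≤ P.ρ := (min_le_left _ _).trans hb.2
  -- `g` is strictly monotone or antitone; the local information at `b₀` excludes antitone
  have hb₀ρ : b₀ + δ ≤ P.ρ := (hI ⟨by linarith, le_rfl⟩).2
  have hb₀T : b₀ ∈ T := ⟨(min_le_right _ _).trans (by linarith), by linarith⟩
  have hb₀δT : b₀ + δ ∈ T := ⟨(min_le_right _ _).trans (by linarith), hb₀ρ⟩
  have hloc : leafLT hbi (P.prongPt hι hx b₀) (P.prongPt hι hx (b₀ + δ)) :=
    leafLT_prongPt_local (hbi := hbi) he hI hsrc hmono ⟨by linarith, by linarith⟩ ⟨by linarith, le_rfl⟩ (by linarith)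
  have hglt : g b₀ < g (b₀ + δ) := (leafLT_iff (hbi := hbi) (hN ⟨b₀, hb₀T, rfl⟩) (hN ⟨_, hb₀δT, rfl⟩)).1 hloc
  have hgmono : StrictMonoOn g T := by
    rcases ContinuousOn.strictMonoOn_of_injOn_Icc' hρT hgc hgi with h | h
    · exact h
    · exact absurd hglt (not_lt.2 (h hb₀T hb₀δT (by linarith)).le)
  have hbT : b ∈ T := ⟨min_le_left _ _, hb.2⟩
  have hb'T : b' ∈ T := ⟨(min_le_left _ _).trans hbb'.le, hb'.2⟩
  exact (leafLT_iff (hbi := hbi) (hN ⟨b, hbT, rfl⟩) (hN ⟨b', hb'T, rfl⟩)).2 (hgmono hbT hb'T hbb')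

/-- **The prong arc is cofinal backward** when traversed forward by increasing parameter.
[folklore] -/
theorem exists_prongPt_lt (hfwd : ∀ b ∈ Ioc 0 P.ρ, ∀ b' ∈ Ioc 0 P.ρ, b < b' → leafLT hbi (P.prongPt hι hx b) (P.prongPt hι hx b'))
    (q : F.Leaf x) : ∃ b ∈ Ioc 0 P.ρ, leafLT hbi (P.prongPt hι hx b) q := by
  by_contra h
  push Not at h
  -- the whole arc lies in the compact leaf interval `[q, prongPt ρ]`
  have hρ : P.ρ ∈ Ioc 0 P.ρ := ⟨P.ρ_pos, le_rfl⟩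
  have hsub : P.prongPt hι hx '' Ioc 0 P.ρ ⊆ leafIcc hbi q (P.prongPt hι hx P.ρ) := by
    rintro _ ⟨b, hb, rfl⟩
    refine ⟨h b hb, fun hlt ↦ ?_⟩
    rcases eq_or_lt_of_le hb.2 with heq | hlt'
    · rw [heq] at hlt; exact leafLT_irrefl _ hlt
    · exact leafLT_asymm (hfwd b hb P.ρ hρ hlt') hlt
  have hK : IsCompact ((fun r : F.Leaf x ↦ ι (Leaf.pt r)) '' leafIcc hbi q (P.prongPt hι hx P.ρ)) :=
    (isCompact_leafIcc q _).image (hι.continuous.comp (Leaf.continuous_coe F x))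
  have hv : v ∈ (fun r : F.Leaf x ↦ ι (Leaf.pt r)) '' leafIcc hbi q (P.prongPt hι hx P.ρ) :=
    hK.isClosed.closure_subset (closure_mono (image_mono hsub) (mem_closure_image_prongPt hρ))
  obtain ⟨r, -, hr⟩ := hv
  exact P.not_mem_range ⟨_, hr⟩

include hx in
/-- **An increasing chart type at one prong point makes the prong an out-prong**: the puncture is
in the α-limit set of the leaf. [folklore] -/
theorem mem_alphaSet_of_strictMonoOn {e : OpenPartialHomeomorph X (ℝ × ℝ)} (he : e ∈ F.atlas) {b₀ δ : ℝ} (hδ : 0 < δ)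
    (hI : Icc (b₀ - δ) (b₀ + δ) ⊆ Ioc 0 P.ρ)
    (hsrc : ∀ β ∈ Icc (b₀ - δ) (b₀ + δ), P.horiz hι j 0 β ∈ e.source ∧ (e (P.horiz hι j 0 β)).2 = (e (P.horiz hι j 0 b₀)).2)
    (hmono : StrictMonoOn (fun β ↦ (e (P.horiz hι j 0 β)).1) (Icc (b₀ - δ) (b₀ + δ))) : v ∈ alphaSet hbi ι x := by
  have hfwd : ∀ b ∈ Ioc 0 P.ρ, ∀ b' ∈ Ioc 0 P.ρ, b < b' → leafLT hbi (P.prongPt hι hx b) (P.prongPt hι hx b') :=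
    fun b hb b' hb' hbb' ↦ leafLT_prongPt_of_lt (hbi := hbi) he hδ hI hsrc hmono hb hb' hbb'
  refine mem_alphaSet_iff.2 fun q ↦ ?_
  obtain ⟨b, hb, hbq⟩ := exists_prongPt_lt (hbi := hbi) hfwd q
  have hcl := mem_closure_image_prongPt (P := P) (hι := hι) (hx := hx) hb
  refine closure_mono (image_mono ?_) hcl
  rintro _ ⟨b', hb', rfl⟩
  -- `prongPt b' ≤ prongPt b < q`
  show ¬ leafLT hbi q (P.prongPt hι hx b')
  rcases eq_or_lt_of_le hb'.2 with heq | hlt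
  · rw [heq]; exact leafLT_asymm hbq
  · exact leafLT_asymm (leafLT_trans (hfwd b' ⟨hb'.1, hb'.2.trans hb.2⟩ b hb hlt) hbq)

/-! ## Decreasing chart type: an in-prong -/

/-- **Global backward order from a decreasing chart type**: the prong arc is traversed backward by
increasing parameter. [folklore] -/
theorem leafLT_prongPt_of_lt' {e : OpenPartialHomeomorph X (ℝ × ℝ)} (he : e ∈ F.atlas) {b₀ δ : ℝ} (hδ : 0 < δ)
    (hI : Icc (b₀ - δ) (b₀ + δ) ⊆ Ioc 0 P.ρ)
    (hsrc : ∀ β ∈ Icc (b₀ - δ) (b₀ + δ), P.horiz hι j 0 β ∈ e.source ∧ (e (P.horiz hι j 0 β)).2 = (e (P.horiz hι j 0 b₀)).2)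
    (hanti : StrictAntiOn (fun β ↦ (e (P.horiz hι j 0 β)).1) (Icc (b₀ - δ) (b₀ + δ)))
    {b b' : ℝ} (hb : b ∈ Ioc 0 P.ρ) (hb' : b' ∈ Ioc 0 P.ρ) (hbb' : b < b') :
    leafLT hbi (P.prongPt hι hx b') (P.prongPt hι hx b) := by
  set b₁ := min b (b₀ - δ) with hb₁
  have hb₁pos : 0 < b₁ := lt_min hb.1 (hI ⟨le_rfl, by linarith⟩).1
  set T := Icc b₁ P.ρ with hT
  have hTsub : T ⊆ Ioc 0 P.ρ := fun β hβ ↦ ⟨hb₁pos.trans_le hβ.1, hβ.2⟩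
  have hcT : ContinuousOn (P.prongPt hι hx) T := continuousOn_prongPt.mono hTsub
  have hKc : IsCompact (P.prongPt hι hx '' T) := isCompact_Icc.image_of_continuousOn hcT
  obtain ⟨N, hN⟩ := exists_subset_lineCharts_source (hbi := hbi) hKc
  set g : ℝ → ℝ := fun β ↦ lineCharts hbi x N (P.prongPt hι hx β) with hg
  have hgc : ContinuousOn g T := (lineCharts hbi x N).continuousOn.comp hcT fun β hβ ↦ hN ⟨β, hβ, rfl⟩
  have hgi : InjOn g T := fun β hβ β' hβ' h ↦
    prongPt_injOn (hTsub hβ) (hTsub hβ') ((lineCharts hbi x N).injOn (hN ⟨β, hβ, rfl⟩) (hN ⟨β', hβ', rfl⟩) h)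
  have hρT : b₁ ≤ P.ρ := (min_le_left _ _).trans hb.2
  have hb₀ρ : b₀ + δ ≤ P.ρ := (hI ⟨by linarith, le_rfl⟩).2
  have hb₀T : b₀ ∈ T := ⟨(min_le_right _ _).trans (by linarith), by linarith⟩
  have hb₀δT : b₀ + δ ∈ T := ⟨(min_le_right _ _).trans (by linarith), hb₀ρ⟩
  -- local information: `prongPt (b₀ + δ) < prongPt b₀`
  have hloc : leafLT hbi (P.prongPt hι hx (b₀ + δ)) (P.prongPt hι hx b₀) := by
    set t := (e (P.horiz hι j 0 b₀)).2 with ht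
    have hplaque : ∀ β ∈ Icc (b₀ - δ) (b₀ + δ), P.horiz hι j 0 β ∈ plaque e t := fun β hβ ↦ ⟨(hsrc β hβ).1, (hsrc β hβ).2⟩
    have hb₀I : b₀ ∈ Icc (b₀ - δ) (b₀ + δ) := ⟨by linarith, by linarith⟩
    have hb₀δI : b₀ + δ ∈ Icc (b₀ - δ) (b₀ + δ) := ⟨by linarith, le_rfl⟩
    have hsub : plaque e t ⊆ F.leaf x := F.plaque_subset_leaf_of_mem he (hx b₀ (hI hb₀I)) (hplaque b₀ hb₀I)
    have hsource : ∀ β (hβ : β ∈ Icc (b₀ - δ) (b₀ + δ)), P.prongPt hι hx β ∈ (leafArc e t hsub he).source := fun β hβ ↦ by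
      rw [mem_leafArc_source_iff]
      show Leaf.pt (P.prongPt hι hx β) ∈ plaque e t
      rw [pt_prongPt (hI hβ)]; exact hplaque β hβ
    rw [← leafArc_lt_iff (hbi := hbi) he hsub (hsource _ hb₀δI) (hsource _ hb₀I), leafArc_apply hsub he (hsource _ hb₀δI),
      leafArc_apply hsub he (hsource _ hb₀I)]
    show (e (Leaf.pt (P.prongPt hι hx (b₀ + δ)))).1 < (e (Leaf.pt (P.prongPt hι hx b₀))).1
    rw [pt_prongPt (hI hb₀δI), pt_prongPt (hI hb₀I)]
    exact hanti hb₀I hb₀δI (by linarith)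
  have hglt : g (b₀ + δ) < g b₀ := (leafLT_iff (hbi := hbi) (hN ⟨_, hb₀δT, rfl⟩) (hN ⟨b₀, hb₀T, rfl⟩)).1 hloc
  have hganti : StrictAntiOn g T := by
    rcases ContinuousOn.strictMonoOn_of_injOn_Icc' hρT hgc hgi with h | h
    · exact absurd hglt (not_lt.2 (h hb₀T hb₀δT (by linarith)).le)
    · exact h
  have hbT : b ∈ T := ⟨min_le_left _ _, hb.2⟩
  have hb'T : b' ∈ T := ⟨(min_le_left _ _).trans hbb'.le, hb'.2⟩
  exact (leafLT_iff (hbi := hbi) (hN ⟨b', hb'T, rfl⟩) (hN ⟨b, hbT, rfl⟩)).2 (hganti hbT hb'T hbb')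

/-- **The prong arc is cofinal forward** when traversed backward by increasing parameter.
[folklore] -/
theorem exists_lt_prongPt (hbwd : ∀ b ∈ Ioc 0 P.ρ, ∀ b' ∈ Ioc 0 P.ρ, b < b' → leafLT hbi (P.prongPt hι hx b') (P.prongPt hι hx b))
    (q : F.Leaf x) : ∃ b ∈ Ioc 0 P.ρ, leafLT hbi q (P.prongPt hι hx b) := by
  by_contra h
  push Not at h
  have hρ : P.ρ ∈ Ioc 0 P.ρ := ⟨P.ρ_pos, le_rfl⟩
  have hsub : P.prongPt hι hx '' Ioc 0 P.ρ ⊆ leafIcc hbi (P.prongPt hι hx P.ρ) q := by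
    rintro _ ⟨b, hb, rfl⟩
    refine ⟨fun hlt ↦ ?_, h b hb⟩
    rcases eq_or_lt_of_le hb.2 with heq | hlt'
    · rw [heq] at hlt; exact leafLT_irrefl _ hlt
    · exact leafLT_asymm (hbwd b hb P.ρ hρ hlt') hlt
  have hK : IsCompact ((fun r : F.Leaf x ↦ ι (Leaf.pt r)) '' leafIcc hbi (P.prongPt hι hx P.ρ) q) :=
    (isCompact_leafIcc _ q).image (hι.continuous.comp (Leaf.continuous_coe F x))
  have hv : v ∈ (fun r : F.Leaf x ↦ ι (Leaf.pt r)) '' leafIcc hbi (P.prongPt hι hx P.ρ) q :=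
    hK.isClosed.closure_subset (closure_mono (image_mono hsub) (mem_closure_image_prongPt hρ))
  obtain ⟨r, -, hr⟩ := hv
  exact P.not_mem_range ⟨_, hr⟩

include hx in
/-- **A decreasing chart type at one prong point makes the prong an in-prong**: the puncture is in
the ω-limit set of the leaf. [folklore] -/
theorem mem_omegaSet_of_strictAntiOn {e : OpenPartialHomeomorph X (ℝ × ℝ)} (he : e ∈ F.atlas) {b₀ δ : ℝ} (hδ : 0 < δ)
    (hI : Icc (b₀ - δ) (b₀ + δ) ⊆ Ioc 0 P.ρ)
    (hsrc : ∀ β ∈ Icc (b₀ - δ) (b₀ + δ), P.horiz hι j 0 β ∈ e.source ∧ (e (P.horiz hι j 0 β)).2 = (e (P.horiz hι j 0 b₀)).2)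
    (hanti : StrictAntiOn (fun β ↦ (e (P.horiz hι j 0 β)).1) (Icc (b₀ - δ) (b₀ + δ))) : v ∈ omegaSet hbi ι x := by
  have hbwd : ∀ b ∈ Ioc 0 P.ρ, ∀ b' ∈ Ioc 0 P.ρ, b < b' → leafLT hbi (P.prongPt hι hx b') (P.prongPt hι hx b) :=
    fun b hb b' hb' hbb' ↦ leafLT_prongPt_of_lt' (hbi := hbi) he hδ hI hsrc hanti hb hb' hbb'
  refine mem_omegaSet_iff.2 fun q ↦ ?_
  obtain ⟨b, hb, hqb⟩ := exists_lt_prongPt (hbi := hbi) hbwd q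
  have hcl := mem_closure_image_prongPt (P := P) (hι := hι) (hx := hx) hb
  refine closure_mono (image_mono ?_) hcl
  rintro _ ⟨b', hb', rfl⟩
  -- `q < prongPt b ≤ prongPt b'`
  show ¬ leafLT hbi (P.prongPt hι hx b') q
  rcases eq_or_lt_of_le hb'.2 with heq | hlt
  · rw [heq]; exact leafLT_asymm hqb
  · exact leafLT_asymm (leafLT_trans hqb (hbwd b' ⟨hb'.1, hb'.2.trans hb.2⟩ b hb hlt))

/-! ## Tails from chart types -/

include hx in
/-- **A backward tail from an increasing chart type**: the whole prong arc, based at its outer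
point, is a backward tail of the leaf at the puncture. [folklore] -/
theorem nonempty_bwdTail_of_strictMonoOn {e : OpenPartialHomeomorph X (ℝ × ℝ)} (he : e ∈ F.atlas) {b₀ δ : ℝ} (hδ : 0 < δ)
    (hI : Icc (b₀ - δ) (b₀ + δ) ⊆ Ioc 0 P.ρ)
    (hsrc : ∀ β ∈ Icc (b₀ - δ) (b₀ + δ), P.horiz hι j 0 β ∈ e.source ∧ (e (P.horiz hι j 0 β)).2 = (e (P.horiz hι j 0 b₀)).2)
    (hmono : StrictMonoOn (fun β ↦ (e (P.horiz hι j 0 β)).1) (Icc (b₀ - δ) (b₀ + δ))) :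
    ∃ E : P.BwdTail hbi x, E.j = j ∧ E.β₀ = P.ρ := by
  have hfwd : ∀ b ∈ Ioc 0 P.ρ, ∀ b' ∈ Ioc 0 P.ρ, b < b' → leafLT hbi (P.prongPt hι hx b) (P.prongPt hι hx b') :=
    fun b hb b' hb' hbb' ↦ leafLT_prongPt_of_lt (hbi := hbi) he hδ hI hsrc hmono hb hb' hbb'
  have hρ : P.ρ ∈ Ioc 0 P.ρ := ⟨P.ρ_pos, le_rfl⟩
  -- the backward half-leaf of the outer point is the prong arc
  have hbwd_iff : ∀ q : F.Leaf x, q ∈ bwd hbi (P.prongPt hι hx P.ρ) ↔ ∃ β ∈ Ioc 0 P.ρ, ι (Leaf.pt q) = P.pt j (β, 0) := by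
    intro q
    constructor
    · intro hq
      -- `q ≤ prongPt ρ`; a prong point below `q`; the arc between is connected, so contains `q`
      obtain ⟨b, hb, hbq⟩ := exists_prongPt_lt (hbi := hbi) hfwd q
      have hqI : q ∈ leafIcc hbi (P.prongPt hι hx b) (P.prongPt hι hx P.ρ) := ⟨fun h ↦ leafLT_asymm hbq h, hq⟩
      have hconn : IsPreconnected (P.prongPt hι hx '' Icc b P.ρ) :=
        (isPreconnected_Icc.image _ (continuousOn_prongPt.mono fun β hβ ↦ ⟨hb.1.trans_le hβ.1, hβ.2⟩))
      have hsub := leafIcc_subset_of_isPreconnected (hbi := hbi) hconn ⟨b, ⟨le_rfl, hb.2⟩, rfl⟩ ⟨P.ρ, ⟨hb.2, le_rfl⟩, rfl⟩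
      obtain ⟨β, hβ, hβq⟩ := hsub hqI
      exact ⟨β, ⟨hb.1.trans_le hβ.1, hβ.2⟩, by rw [← hβq]; exact ι_prongPt ⟨hb.1.trans_le hβ.1, hβ.2⟩⟩
    · rintro ⟨β, hβ, hβq⟩
      have hq : q = P.prongPt hι hx β := by
        apply Leaf.injective_coe F x
        apply hι.injective
        show ι (Leaf.pt q) = ι (Leaf.pt (P.prongPt hι hx β))
        rw [hβq, ι_prongPt hβ]
      rw [hq]
      show ¬ leafLT hbi (P.prongPt hι hx P.ρ) (P.prongPt hι hx β)
      rcases eq_or_lt_of_le hβ.2 with h | h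
      · rw [h]; exact leafLT_irrefl _
      · exact leafLT_asymm (hfwd β hβ P.ρ hρ h)
  refine ⟨{ j := j, p := P.prongPt hι hx P.ρ, β₀ := P.ρ, hβ₀ := hρ, hp := ι_prongPt hρ, bwd_iff := hbwd_iff, mem_closure := ?_ }, rfl, rfl⟩
  refine closure_mono (image_mono ?_) (mem_closure_image_prongPt (P := P) (hι := hι) (hx := hx) hρ)
  rintro _ ⟨β, hβ, rfl⟩
  exact (hbwd_iff _).2 ⟨β, hβ, ι_prongPt hβ⟩

include hx in
/-- **A forward tail from a decreasing chart type**: the whole prong arc, based at its outer point,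
is a forward tail of the leaf at the puncture. [folklore] -/
theorem nonempty_fwdTail_of_strictAntiOn {e : OpenPartialHomeomorph X (ℝ × ℝ)} (he : e ∈ F.atlas) {b₀ δ : ℝ} (hδ : 0 < δ)
    (hI : Icc (b₀ - δ) (b₀ + δ) ⊆ Ioc 0 P.ρ)
    (hsrc : ∀ β ∈ Icc (b₀ - δ) (b₀ + δ), P.horiz hι j 0 β ∈ e.source ∧ (e (P.horiz hι j 0 β)).2 = (e (P.horiz hι j 0 b₀)).2)
    (hanti : StrictAntiOn (fun β ↦ (e (P.horiz hι j 0 β)).1) (Icc (b₀ - δ) (b₀ + δ))) :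
    ∃ E : P.FwdTail hbi x, E.j = j ∧ E.β₀ = P.ρ := by
  have hbwd : ∀ b ∈ Ioc 0 P.ρ, ∀ b' ∈ Ioc 0 P.ρ, b < b' → leafLT hbi (P.prongPt hι hx b') (P.prongPt hι hx b) :=
    fun b hb b' hb' hbb' ↦ leafLT_prongPt_of_lt' (hbi := hbi) he hδ hI hsrc hanti hb hb' hbb'
  have hρ : P.ρ ∈ Ioc 0 P.ρ := ⟨P.ρ_pos, le_rfl⟩
  have hfwd_iff : ∀ q : F.Leaf x, q ∈ fwd hbi (P.prongPt hι hx P.ρ) ↔ ∃ β ∈ Ioc 0 P.ρ, ι (Leaf.pt q) = P.pt j (β, 0) := by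
    intro q
    constructor
    · intro hq
      obtain ⟨b, hb, hqb⟩ := exists_lt_prongPt (hbi := hbi) hbwd q
      have hqI : q ∈ leafIcc hbi (P.prongPt hι hx P.ρ) (P.prongPt hι hx b) := ⟨hq, fun h ↦ leafLT_asymm hqb h⟩
      have hconn : IsPreconnected (P.prongPt hι hx '' Icc b P.ρ) :=
        (isPreconnected_Icc.image _ (continuousOn_prongPt.mono fun β hβ ↦ ⟨hb.1.trans_le hβ.1, hβ.2⟩))
      have hsub := leafIcc_subset_of_isPreconnected (hbi := hbi) hconn ⟨P.ρ, ⟨hb.2, le_rfl⟩, rfl⟩ ⟨b, ⟨le_rfl, hb.2⟩, rfl⟩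
      obtain ⟨β, hβ, hβq⟩ := hsub hqI
      exact ⟨β, ⟨hb.1.trans_le hβ.1, hβ.2⟩, by rw [← hβq]; exact ι_prongPt ⟨hb.1.trans_le hβ.1, hβ.2⟩⟩
    · rintro ⟨β, hβ, hβq⟩
      have hq : q = P.prongPt hι hx β := by
        apply Leaf.injective_coe F x
        apply hι.injective
        show ι (Leaf.pt q) = ι (Leaf.pt (P.prongPt hι hx β))
        rw [hβq, ι_prongPt hβ]
      rw [hq]
      show ¬ leafLT hbi (P.prongPt hι hx β) (P.prongPt hι hx P.ρ)
      rcases eq_or_lt_of_le hβ.2 with h | h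
      · rw [h]; exact leafLT_irrefl _
      · exact leafLT_asymm (hbwd β hβ P.ρ hρ h)
  refine ⟨{ j := j, p := P.prongPt hι hx P.ρ, β₀ := P.ρ, hβ₀ := hρ, hp := ι_prongPt hρ, fwd_iff := hfwd_iff, mem_closure := ?_ }, rfl, rfl⟩
  refine closure_mono (image_mono ?_) (mem_closure_image_prongPt (P := P) (hι := hι) (hx := hx) hρ)
  rintro _ ⟨β, hβ, rfl⟩
  exact (hfwd_iff _).2 ⟨β, hβ, ι_prongPt hβ⟩

/-! ## Chart types from tails -/

include hx in
/-- **A prong carrying a forward tail has decreasing chart type**: an increasing type near a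
parameter inside the tail is impossible. [folklore] -/
theorem not_strictMonoOn_of_fwdTail (E : P.FwdTail hbi x) (hEj : E.j = j) (hω : v ∈ omegaSet hbi ι x)
    {e : OpenPartialHomeomorph X (ℝ × ℝ)} (he : e ∈ F.atlas) {b₀ δ : ℝ} (hδ : 0 < δ) (hI : Icc (b₀ - δ) (b₀ + δ) ⊆ Ioc 0 E.β₀)
    (hsrc : ∀ β ∈ Icc (b₀ - δ) (b₀ + δ), P.horiz hι j 0 β ∈ e.source ∧ (e (P.horiz hι j 0 β)).2 = (e (P.horiz hι j 0 b₀)).2) :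
    ¬ StrictMonoOn (fun β ↦ (e (P.horiz hι j 0 β)).1) (Icc (b₀ - δ) (b₀ + δ)) := by
  intro hmono
  have hI' : Icc (b₀ - δ) (b₀ + δ) ⊆ Ioc 0 P.ρ := fun β hβ ↦ ⟨(hI hβ).1, (hI hβ).2.trans E.hβ₀.2⟩
  have h₁ : b₀ ∈ Icc (b₀ - δ) (b₀ + δ) := ⟨by linarith, by linarith⟩
  have h₂ : b₀ + δ ∈ Icc (b₀ - δ) (b₀ + δ) := ⟨by linarith, le_rfl⟩
  -- increasing type: `prongPt b₀ < prongPt (b₀ + δ)`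
  have hlt : leafLT hbi (P.prongPt hι hx b₀) (P.prongPt hι hx (b₀ + δ)) :=
    leafLT_prongPt_local (hbi := hbi) he hI' hsrc hmono h₁ h₂ (by linarith)
  -- forward tail: smaller parameter is later
  have hq₁ : P.prongPt hι hx b₀ ∈ fwd hbi E.p := (E.fwd_iff _).2 ⟨b₀, hI h₁, by rw [hEj]; exact ι_prongPt (hI' h₁)⟩
  have hq₂ : P.prongPt hι hx (b₀ + δ) ∈ fwd hbi E.p := (E.fwd_iff _).2 ⟨b₀ + δ, hI h₂, by rw [hEj]; exact ι_prongPt (hI' h₂)⟩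
  have hb₁ : P.b E.j (ι (Leaf.pt (P.prongPt hι hx b₀))) = b₀ := by
    rw [hEj, ι_prongPt (hI' h₁), P.b_pt (rect_of_mem_Ioc (hI' h₁)).1]
  have hb₂ : P.b E.j (ι (Leaf.pt (P.prongPt hι hx (b₀ + δ)))) = b₀ + δ := by
    rw [hEj, ι_prongPt (hI' h₂), P.b_pt (rect_of_mem_Ioc (hI' h₂)).1]
  have hgt : leafLT hbi (P.prongPt hι hx (b₀ + δ)) (P.prongPt hι hx b₀) := by
    rw [E.leafLT_iff_b_lt hι hω hq₂ hq₁, hb₁, hb₂]; linarith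
  exact leafLT_asymm hlt hgt

include hx in
/-- **A prong carrying a backward tail has increasing chart type.** [folklore] -/
theorem not_strictAntiOn_of_bwdTail (E : P.BwdTail hbi x) (hEj : E.j = j) (hα : v ∈ alphaSet hbi ι x)
    {e : OpenPartialHomeomorph X (ℝ × ℝ)} (he : e ∈ F.atlas) {b₀ δ : ℝ} (hδ : 0 < δ) (hI : Icc (b₀ - δ) (b₀ + δ) ⊆ Ioc 0 E.β₀)
    (hsrc : ∀ β ∈ Icc (b₀ - δ) (b₀ + δ), P.horiz hι j 0 β ∈ e.source ∧ (e (P.horiz hι j 0 β)).2 = (e (P.horiz hι j 0 b₀)).2) :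
    ¬ StrictAntiOn (fun β ↦ (e (P.horiz hι j 0 β)).1) (Icc (b₀ - δ) (b₀ + δ)) := by
  intro hanti
  have hI' : Icc (b₀ - δ) (b₀ + δ) ⊆ Ioc 0 P.ρ := fun β hβ ↦ ⟨(hI hβ).1, (hI hβ).2.trans E.hβ₀.2⟩
  have h₁ : b₀ ∈ Icc (b₀ - δ) (b₀ + δ) := ⟨by linarith, by linarith⟩
  have h₂ : b₀ + δ ∈ Icc (b₀ - δ) (b₀ + δ) := ⟨by linarith, le_rfl⟩
  -- decreasing type, read through the leaf arc: `prongPt (b₀ + δ) < prongPt b₀`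
  have hlt : leafLT hbi (P.prongPt hι hx (b₀ + δ)) (P.prongPt hι hx b₀) := by
    set t := (e (P.horiz hι j 0 b₀)).2 with ht
    have hplaque : ∀ β ∈ Icc (b₀ - δ) (b₀ + δ), P.horiz hι j 0 β ∈ plaque e t := fun β hβ ↦ ⟨(hsrc β hβ).1, (hsrc β hβ).2⟩
    have hsub : plaque e t ⊆ F.leaf x := F.plaque_subset_leaf_of_mem he (hx b₀ (hI' h₁)) (hplaque b₀ h₁)
    have hsource : ∀ β (hβ : β ∈ Icc (b₀ - δ) (b₀ + δ)), P.prongPt hι hx β ∈ (leafArc e t hsub he).source := fun β hβ ↦ by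
      rw [mem_leafArc_source_iff]
      show Leaf.pt (P.prongPt hι hx β) ∈ plaque e t
      rw [pt_prongPt (hI' hβ)]; exact hplaque β hβ
    rw [← leafArc_lt_iff (hbi := hbi) he hsub (hsource _ h₂) (hsource _ h₁), leafArc_apply hsub he (hsource _ h₂),
      leafArc_apply hsub he (hsource _ h₁)]
    show (e (Leaf.pt (P.prongPt hι hx (b₀ + δ)))).1 < (e (Leaf.pt (P.prongPt hι hx b₀))).1
    rw [pt_prongPt (hI' h₂), pt_prongPt (hI' h₁)]
    exact hanti h₁ h₂ (by linarith)
  have hq₁ : P.prongPt hι hx b₀ ∈ bwd hbi E.p := (E.bwd_iff _).2 ⟨b₀, hI h₁, by rw [hEj]; exact ι_prongPt (hI' h₁)⟩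
  have hq₂ : P.prongPt hι hx (b₀ + δ) ∈ bwd hbi E.p := (E.bwd_iff _).2 ⟨b₀ + δ, hI h₂, by rw [hEj]; exact ι_prongPt (hI' h₂)⟩
  have hb₁ : P.b E.j (ι (Leaf.pt (P.prongPt hι hx b₀))) = b₀ := by
    rw [hEj, ι_prongPt (hI' h₁), P.b_pt (rect_of_mem_Ioc (hI' h₁)).1]
  have hb₂ : P.b E.j (ι (Leaf.pt (P.prongPt hι hx (b₀ + δ)))) = b₀ + δ := by
    rw [hEj, ι_prongPt (hI' h₂), P.b_pt (rect_of_mem_Ioc (hI' h₂)).1]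
  have hgt : leafLT hbi (P.prongPt hι hx b₀) (P.prongPt hι hx (b₀ + δ)) := by
    rw [E.leafLT_iff_b_lt hι hα hq₂ hq₁, hb₁, hb₂]; linarith
  exact leafLT_asymm hlt hgt

end ProngStar

end Literature.Topology.PlanarFoliations
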